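import Summits.BirchSwinnertonDyer.BirchSwinnertonDyer.Theorems.SignedBaseChangeAnticyclotomicEisensteinDivisibilityTwistDeformationDeterminant
import Summits.BirchSwinnertonDyer.BirchSwinnertonDyer.Theorems.EisensteinPrimesGreenbergCorankAlgebra
import Summits.BirchSwinnertonDyer.BirchSwinnertonDyer.Theorems.EisensteinPrimesTwistDeformationSigmaSupply
import Summits.BirchSwinnertonDyer.BirchSwinnertonDyer.Theorems.SignedBaseChangeAnticyclotomicEisensteinDivisibilityCofreeTateDual
import Summits.BirchSwinnertonDyer.BirchSwinnertonDyer.Theorems.SignedBaseChangeAnticyclotomicEisensteinDivisibilityFiniteExponentTelescope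
import HarnessLib

/-!
# Greenberg 2010 Lemma 5.2.2 for the twist deformation of a cofree `A` of ANY corank and ANY `ρ₀` —
# LOC_v⁽¹⁾(`𝐃`), `corank H⁰(K_v, 𝐃) = 0`, `corank H⁰(K_Σ/K, 𝐃) = 0` — and the registered stub
# `stub_twistDeformationLOC1SS` of line `bdpline` (v19) for `𝐃 = Ind_{K̃_∞/K} E_K[p^∞]`, PROVED
# (crux `AnticyclotomicEisensteinDivisibility`, stmt-BirchSwinnertonDyer-20727)

Cell `bsd-ssimc` (hosting route `SignedBaseChange`), width seat `bsd-line-sbc-p1-w2` gen 4; third file of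
the lane (after `…CoinducedDualFunctorial` p630273 and `…TwistDeformationDeterminant`). Brick (R1b) of the
Greenberg-2016 road for `stub_finiteExponentSS` (bsd-line-sbc-p1-w2 gen 3, note
`finite-exponent-greenberg-road-w2g3.md`; hypothesis `hR1b` of
`SignedBaseChangeAcDivNoPseudoNull.xGr₂_torsionBy_X_finiteExponent_of_bricks` p627602 and of the lead's
telescope `SignedBaseChangeAcDivFiniteExponentTelescope.finiteExponent_of_bricks`), registered by the lead
(bsd-line-sbc-p1 gen 3) as `stub_twistDeformationLOC1SS` of skeleton bdpline v19 — PROVED here, verbatim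
signature, by the DETERMINANT form of [Greenberg2010] Lemma 5.2.2:

* §1 `hasCorank_H0_zero_of_forall_fixed_smul_eq_zero`: `corank_Λ H⁰(G, 𝐃) = 0` as soon as the vectors
  fixed by ONE `g` are killed by a non-zero scalar of the domain `Λ` (Mathlib `ContinuousCohomology.zeroIso`).
* §2 for ANY `p`-primary cofree `A` over a domain `𝒪 ⊇ ℤ_p` and ANY `ρ₀`: `localRep_twistDeformation_eq_mapRange`
  (`σ` acts on `𝐃` as `ρ₀(σ̄)_{**} ∘ (γ₁^{-κ₁σ}γ₂^{-κ₂σ} • ·)`), **`twistDeformation_LOC1_of_basis`** (LOC_v⁽¹⁾ from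
  ONE `σ ∈ Γ_{K_v}` with `κ(σ) ≠ 1`, given a Tate-dual basis — no condition on `ρ₀(σ)` or on `σ|μ_{p^∞}`),
  **`hasCorank_localH0_zero_of_basis`**, **`hasCorank_H0_zero_of_basis`** (given a Pontryagin-dual basis).
* §3 `loc1_and_hasCorank_H0_zero_curve`: for `W/K` elliptic, `K` imaginary quadratic and a generator pair,
  for EVERY `S ⊇ {w ∣ p}` and EVERY `ρ₀` on `E[p^∞]`: LOC_w⁽¹⁾ and `corank H⁰(K_w, 𝐃) = 0` at EVERY finite `w`,
  and `corank H⁰(K_Σ/K, 𝐃) = 0` — inputs: (R1a) `SignedBaseChangeAcDivCofree.isCofree_primaryTorsion` /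
  `exists_tateDual_basis_primaryTorsion` (bsd-line-sbc-p1-w3, p628727) and the `σ`-supply
  `GreenbergFullAtSelmer.exists_resGal_apply_ne_one_of_isTopGeneratorPair` (bsd-eis: no finite prime splits
  completely in `K̃_∞ ⊇ K_∞^{cyc}`); then **`stub_twistDeformationLOC1SS`** (registered signature verbatim).

Theorems only; no definition, no named fact, no `sorry`. HONEST FRAMING: proves ONE registered stub of
line `bdpline` (`--supports stmt-BirchSwinnertonDyer-20727`); with `stub_primaryTorsionCofreeSS` (R1a) and
`stub_greenberg2016FactsSS` (six PUBLISHED facts, by name) the skeleton derives `stub_finiteExponentSS`;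
the crux itself stays open (stubs `stub_ordSlice`, `stub_xAcTorsionSS`, `stub_greenberg2016FactsSS`,
`stub_bdpLowerHalfRatSS`, `stub_minusIsBDP`); no summit statement / BSD is proved by this file.
References: [Greenberg2010] R. Greenberg, *Surjectivity of the global-to-local map defining a Selmer
group*, Kyoto J. Math. 50 (2010), Lemma 5.2.2 (PDF p. 28 L20–21); [Greenberg2006] R. Greenberg, *On the
structure of certain Galois cohomology groups*, Doc. Math. (2006), p. 342, §4 A Props. 4.1–4.2
pp. 367–368; [Greenberg2016Selmer] R. Greenberg, *On the structure of Selmer groups* (2016), §2.1 p. 6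
(LOC⁽¹⁾), §4.3 p. 20 L26–30 ("that hypothesis holds for any prime `η` which does not split completely").
-/

-- `Summit.BirchSwinnertonDyer.BirchSwinnertonDyer.…`: summit and sub-problem share a name (D-0017 layout).
set_option linter.dupNamespace false
set_option autoImplicit false

noncomputable section

open scoped Classical
open PowerSeries NumberField IsDedekindDomain Field
open Literature.NumberTheory.EllipticCurves Literature.NumberTheory.EllipticCurves.BigRepModule
  Literature.NumberTheory.GaloisRepresentations
  Literature.NumberTheory.IwasawaTheory.Greenberg2016 Literature.NumberTheory.IwasawaTheory.Greenberg2006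

universe u

namespace Summit.BirchSwinnertonDyer.BirchSwinnertonDyer.Theorems.SignedBaseChangeAcDivTwistLOC1

open SignedBaseChangeAcDivDeterminant GreenbergFullAtSelmer SignedBaseChangeAcDivCofree
  SignedBaseChangeAcDivFiniteExponentTelescope

/-! ## §1 `corank H⁰(G, 𝐃) = 0` from ONE element whose fixed vectors are killed by a non-zero scalar -/

section H0

variable {Λ : Type u} [CommRing Λ] [IsDomain Λ] [TopologicalSpace Λ]
  {G : Type u} [Group G] [TopologicalSpace G] [IsTopologicalGroup G]
  {D : Type u} [AddCommGroup D] [Module Λ D] [TopologicalSpace D] [IsTopologicalAddGroup D]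
  [ContinuousSMul Λ D]

/-- **`corank_Λ H⁰(G, 𝐃) = 0` as soon as the vectors fixed by ONE `g ∈ G` are killed by a non-zero scalar
`a` of the domain `Λ`** (`H⁰(G, 𝐃) = 𝐃^G ≤ 𝐃^g`, Mathlib `ContinuousCohomology.zeroIso`; the corank-one
case `g` acting as a scalar `u ≠ 1`, `a = u − 1`, is `GreenbergFullAtSelmer.hasCorank_H0_zero_of_exists_smul`).
[cite: Greenberg2006, Prop. 4.1 / 4.2 (§4 A, pp. 367–368: the terms corank H⁰)] -/
theorem hasCorank_H0_zero_of_forall_fixed_smul_eq_zero (τ : ContinuousRep G Λ D) (g : G) {a : Λ}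
    (ha : a ≠ 0) (hg : ∀ d : D, τ g d = d → a • d = 0) : HasCorank Λ (τ.H 0) 0 := by
  have e : τ.H 0 ≃ₗ[Λ] τ.toTopRep.ρ.invariants :=
    (ContinuousCohomology.zeroIso τ.toTopRep).toContinuousLinearEquiv.toLinearEquiv
  refine hasCorank_of_linearEquiv e.symm (hasCorank_zero_of_forall_smul_eq_zero ha ?_)
  rintro ⟨d, hd⟩
  apply Subtype.ext
  exact hg d (hd g)

end H0

section Generic

variable {G : Type*} [Group G] [TopologicalSpace G] {R : Type*} [CommRing R] [TopologicalSpace R]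
  {M : Type*} [AddCommGroup M] [Module R M] [TopologicalSpace M]

/-- `ρ(g)` is invertible with inverse `ρ(g⁻¹)` for a continuous representation `ρ`. [folklore] -/
theorem apply_apply_inv (ρ : ContinuousRep G R M) (g : G) (a : M) : ρ g (ρ g⁻¹ a) = a := by
  rw [← Module.End.mul_apply, ← map_mul, mul_inv_cancel, map_one, Module.End.one_apply]

/-- `κ(σ) ≠ (1, 1)` in `Γ = ℤ_p²` (multiplicative notation) iff `-κ(σ) ≠ (0, 0)` additively. [folklore] -/
theorem neg_toAdd_ne_zero_or {p : ℕ} [Fact p.Prime] {c₁ c₂ : Multiplicative ℤ_[p]} (h : c₁ ≠ 1 ∨ c₂ ≠ 1) :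
    -c₁.toAdd ≠ 0 ∨ -c₂.toAdd ≠ 0 := by
  rcases h with h | h
  · exact Or.inl (neg_ne_zero.mpr fun h0 ↦ h (toAdd_eq_zero.mp h0))
  · exact Or.inr (neg_ne_zero.mpr fun h0 ↦ h (toAdd_eq_zero.mp h0))

end Generic

/-! ## §2 Greenberg 2010 Lemma 5.2.2 for the twist deformation of a cofree `A` of ANY corank, ANY `ρ₀`:
LOC_v⁽¹⁾(`𝐃`), `corank H⁰(K_v, 𝐃) = 0`, `corank H⁰(K_Σ/K, 𝐃) = 0` -/

section Wrappers

variable {K : Type} [Field K] [NumberField K] (S : Set (HeightOneSpectrum (𝓞 K))) {p : ℕ} [Fact p.Prime]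
  {𝒪 : Type} [CommRing 𝒪] [IsDomain 𝒪] [Algebra ℤ_[p] 𝒪] [TopologicalSpace 𝒪]
  {A : Type} [AddCommGroup A] [Module 𝒪 A] [TopologicalSpace A] [DiscreteTopology A]
  [TopologicalSpace (PowerSeries 𝒪)] [TopologicalSpace (PowerSeries (PowerSeries 𝒪))]
  (hS : ∀ v : HeightOneSpectrum (𝓞 K), ((p : ℕ) : 𝓞 K) ∈ v.asIdeal → v ∈ S)
  (κ₁ κ₂ : ZpExtension K p) (ρ₀ : ContinuousRep (GaloisGroupUnramifiedOutside K S) 𝒪 A)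

omit [IsDomain 𝒪] in
/-- **`σ ∈ Γ_{K_v}` acts on `𝐃 = Ind(A)` as `ρ₀(σ̄)_{**} ∘ (γ₁^{-κ₁σ} γ₂^{-κ₂σ} • ·)`**: the matrix part
(pointwise `ρ₀(σ̄)`, `BigRepModule.mapRange` in both variables) after the group-like part
(`IndModule₂.transSeries_smul_apply`) — `ρ = ρ₀ ⊗ κ⁻¹`. [cite: Greenberg2006, p. 342 L5 (ρ = ρ₀ ⊗ κ^{-1})]
[cite: Greenberg2010, §5 (PDF p. 26 L3–17)] -/
theorem localRep_twistDeformation_eq_mapRange (v : Place K) (σ : absoluteGaloisGroup v.Completion)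
    (Φ : IndModule₂ 𝒪 p A) :
    localRep S (twistDeformation S hS κ₁ κ₂ ρ₀) v σ Φ =
      mapRange (mapRangeₗ (ρ₀ (localToUnramified S v σ)))
        (IndModule₂.transSeries 𝒪 (-(κ₁ (absGaloisRestrict K v.Completion σ)).toAdd)
          (-(κ₂ (absGaloisRestrict K v.Completion σ)).toAdd) • Φ) := by
  ext x t
  show ρ₀ (localToUnramified S v σ) (Φ (x - (κ₁ (absGaloisRestrict K v.Completion σ)).toAdd)
      (t - (κ₂ (absGaloisRestrict K v.Completion σ)).toAdd)) = _
  rw [mapRange_apply, mapRangeₗ_apply, mapRange_apply, IndModule₂.transSeries_smul_apply, ← sub_eq_add_neg,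
    ← sub_eq_add_neg]

omit [IsDomain 𝒪] in
/-- The same for `g ∈ G_{K,S}`: `ρ(g) = ρ₀(g)_{**} ∘ (γ₁^{-κ₁ g} γ₂^{-κ₂ g} • ·)`.
[cite: Greenberg2006, p. 342 L5 (ρ = ρ₀ ⊗ κ^{-1})] [cite: Greenberg2010, §5 (PDF p. 26 L3–17)] -/
theorem twistDeformation_eq_mapRange (g : GaloisGroupUnramifiedOutside K S) (Φ : IndModule₂ 𝒪 p A) :
    twistDeformation S hS κ₁ κ₂ ρ₀ g Φ =
      mapRange (mapRangeₗ (ρ₀ g))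
        (IndModule₂.transSeries 𝒪 (-(κ₁.liftUnramifiedOutside S hS g).toAdd)
          (-(κ₂.liftUnramifiedOutside S hS g).toAdd) • Φ) := by
  ext x t
  rw [twistDeformation_apply, mapRange_apply, mapRangeₗ_apply, mapRange_apply,
    IndModule₂.transSeries_smul_apply, ← sub_eq_add_neg, ← sub_eq_add_neg]

/-- **Greenberg 2010 Lemma 5.2.2 — LOC_v⁽¹⁾(`𝐃`) for the twist deformation of a cofree `A` of ANY corank
and ANY `ρ₀`: "Suppose that `v ∈ Σ` and that the decomposition subgroup of `Γ` for `v` is nontrivial.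
Then `H⁰(K_v, T*) = 0`."** Hypotheses: `A` `p`-primary with a Tate dual `Hom(A, K̄ˣ)` free of rank `n`
over the domain `𝒪 ⊇ ℤ_p` (`hY`, `b`), and ONE `σ ∈ Γ_{K_v}` with `κ(σ) ≠ 1` — no condition on `ρ₀(σ)`
(not a scalar), none on `σ|μ_{p^∞}` (its adjoint is a constant matrix for free). Proof: LOC-core
`eq_zero_of_apply_mapRange_transSeries_smul` with `M = ρ₀(σ̄)`, `s = σ|_{K̄ˣ}`. Supersedes, for cofree `A`,
`Greenberg2006.twistDeformation_LOC1_of_ne_one` (`ρ₀(σ) = 1`, `σ` fixing `μ`) and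
`TwistDeformationCofree.twistDeformation_LOC1` (corank one, scalar action).
[cite: Greenberg2010, Lemma 5.2.2 (PDF p. 28 L20–21)] [cite: Greenberg2006, p. 342 L35–36]
[cite: Greenberg2016Selmer, §4.3 p. 20 L26–30] -/
theorem twistDeformation_LOC1_of_basis (hinj : Function.Injective (algebraMap ℤ_[p] 𝒪))
    (hA : ∀ a : A, ∃ k : ℕ, p ^ k • a = 0) {Y : Type} [AddCommGroup Y] [Module 𝒪 Y]
    {tA : Y →+ (A →+ DiscreteGaloisModule.UnitsCarrier K)} (hY : IsDualPairing 𝒪 A tA) {n : ℕ}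
    (b : Module.Basis (Fin n) 𝒪 Y) (v : Place K) (σ : absoluteGaloisGroup v.Completion)
    (hκ : κ₁ (absGaloisRestrict K v.Completion σ) ≠ 1 ∨ κ₂ (absGaloisRestrict K v.Completion σ) ≠ 1) :
    LOC1 S (twistDeformation S hS κ₁ κ₂ ρ₀) v := by
  intro f hf
  exact eq_zero_of_apply_mapRange_transSeries_smul hinj hA hY b (ρ₀ (localToUnramified S v σ))
    (ρ₀ (localToUnramified S v σ)⁻¹) (apply_apply_inv ρ₀ _ ) (neg_toAdd_ne_zero_or hκ)
    (DiscreteGaloisModule.units K (absGaloisRestrict K v.Completion σ)).toAddMonoidHom f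
    fun Φ ↦ by rw [← localRep_twistDeformation_eq_mapRange]; exact hf σ Φ

/-- **`corank_{Λ₂} H⁰(K_v, 𝐃) = 0` for the twist deformation of a cofree `A` of ANY corank and ANY `ρ₀`**,
from ONE `σ ∈ Γ_{K_v}` with `κ(σ) ≠ 1` and a free Pontryagin dual of `A` (`hY₀`, `b₀`): the H⁰-core
scalar `det(u · Q_{ρ₀(σ̄)} − 1) ≠ 0` kills `𝐃^σ ⊇ 𝐃^{Γ_{K_v}}`. The input `h₀ = 0` of
[Greenberg2006] Prop. 4.2 for `𝐃`. [cite: Greenberg2006, Prop. 4.2 (§4 A, p. 368)] [cite: Greenberg2010, Lemma 5.2.2 (PDF p. 28 L20–21)] -/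
theorem hasCorank_localH0_zero_of_basis [IsTopologicalAddGroup (IndModule₂ 𝒪 p A)]
    [ContinuousSMul (PowerSeries (PowerSeries 𝒪)) (IndModule₂ 𝒪 p A)]
    (hinj : Function.Injective (algebraMap ℤ_[p] 𝒪)) (hA : ∀ a : A, ∃ k : ℕ, p ^ k • a = 0)
    {Y₀ : Type} [AddCommGroup Y₀] [Module 𝒪 Y₀] {t₀ : Y₀ →+ (A →+ AddCircle (1 : ℚ))}
    (hY₀ : IsDualPairing 𝒪 A t₀) {n₀ : ℕ} (b₀ : Module.Basis (Fin n₀) 𝒪 Y₀)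
    (v : Place K) (σ : absoluteGaloisGroup v.Completion)
    (hκ : κ₁ (absGaloisRestrict K v.Completion σ) ≠ 1 ∨ κ₂ (absGaloisRestrict K v.Completion σ) ≠ 1) :
    HasCorank (PowerSeries (PowerSeries 𝒪)) ((localRep S (twistDeformation S hS κ₁ κ₂ ρ₀) v).H 0) 0 := by
  obtain ⟨lam, hlam, hkill⟩ := exists_ne_zero_smul_eq_zero_of_mapRange_transSeries_smul_eq hinj hA hY₀ b₀
    (ρ₀ (localToUnramified S v σ)) (ρ₀ (localToUnramified S v σ)⁻¹) (apply_apply_inv ρ₀ _ )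
    (neg_toAdd_ne_zero_or hκ)
  exact hasCorank_H0_zero_of_forall_fixed_smul_eq_zero _ σ hlam fun Φ hΦ ↦
    hkill Φ (by rw [← localRep_twistDeformation_eq_mapRange]; exact hΦ)

/-- **`corank_{Λ₂} H⁰(K_Σ/K, 𝐃) = 0` for the twist deformation of a cofree `A` of ANY corank and ANY `ρ₀`**:
some `g ∈ G_{K,S}` has `κ₁(g) = γ₁` (`liftUnramifiedOutside_surjective`), and the H⁰-core scalar for `g`
kills `𝐃^{G_{K,S}}`. The input `h₀ = 0` of [Greenberg2006] Prop. 4.1. [cite: Greenberg2006, Prop. 4.1 (§4 A, p. 367)]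
[cite: Greenberg2010, Lemma 5.2.2 (PDF p. 28 L20–21)] -/
theorem hasCorank_H0_zero_of_basis [IsTopologicalAddGroup (IndModule₂ 𝒪 p A)]
    [ContinuousSMul (PowerSeries (PowerSeries 𝒪)) (IndModule₂ 𝒪 p A)]
    (hinj : Function.Injective (algebraMap ℤ_[p] 𝒪)) (hA : ∀ a : A, ∃ k : ℕ, p ^ k • a = 0)
    {Y₀ : Type} [AddCommGroup Y₀] [Module 𝒪 Y₀] {t₀ : Y₀ →+ (A →+ AddCircle (1 : ℚ))}
    (hY₀ : IsDualPairing 𝒪 A t₀) {n₀ : ℕ} (b₀ : Module.Basis (Fin n₀) 𝒪 Y₀) :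
    HasCorank (PowerSeries (PowerSeries 𝒪)) ((twistDeformation S hS κ₁ κ₂ ρ₀).H 0) 0 := by
  obtain ⟨g, hg⟩ := κ₁.liftUnramifiedOutside_surjective S hS (Multiplicative.ofAdd 1)
  have hc : -(κ₁.liftUnramifiedOutside S hS g).toAdd ≠ 0 ∨ -(κ₂.liftUnramifiedOutside S hS g).toAdd ≠ 0 :=
    Or.inl (by rw [hg, toAdd_ofAdd]; norm_num)
  obtain ⟨lam, hlam, hkill⟩ := exists_ne_zero_smul_eq_zero_of_mapRange_transSeries_smul_eq hinj hA hY₀ b₀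
    (ρ₀ g) (ρ₀ g⁻¹) (apply_apply_inv ρ₀ g) hc
  exact hasCorank_H0_zero_of_forall_fixed_smul_eq_zero _ g hlam fun Φ hΦ ↦
    hkill Φ (by rw [← twistDeformation_eq_mapRange]; exact hΦ)

end Wrappers

/-! ## §3 The instance `A = E_K[p^∞]`: brick (R1b) for EVERY `S ⊇ {w ∣ p}` and EVERY `ρ₀`, and the
registered stub `stub_twistDeformationLOC1SS` of line `bdpline` v19 -/

section Curve

variable {K : Type} [Field K] [NumberField K] {p : ℕ} [Fact p.Prime] (W : WeierstrassCurve K) [W.IsElliptic]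
  (κ₁ κ₂ : ZpExtension K p)

/-- **Brick (R1b) of the Greenberg-2016 road for `E_K[p^∞]`, PROVED**: for `K` imaginary quadratic and a
generator pair `(κ₁, κ₂; γ₁, γ₂)` of the `ℤ_p²`-tower, for EVERY `S ⊇ {w ∣ p}` and EVERY continuous
`ρ₀ : G_{K,S} → Aut_{ℤ_p} E[p^∞]`: LOC_w⁽¹⁾(`𝐃`) and `corank H⁰(K_w, 𝐃) = 0` at EVERY finite place `w`, and
`corank H⁰(K_Σ/K, 𝐃) = 0`, for `𝐃 = Ind_{K̃_∞/K} E_K[p^∞]`. Inputs: the Tate-dual basis and cofreeness of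
`E[p^∞]` ((R1a), `SignedBaseChangeAcDivCofree`, p628727), the `σ`-supply at every finite place
(`exists_resGal_apply_ne_one_of_isTopGeneratorPair`: no finite prime splits completely in `K̃_∞ ⊇ K_∞^{cyc}`),
and §2. [cite: Greenberg2010, Lemma 5.2.2 (PDF p. 28 L20–21)] [cite: Greenberg2016Selmer, §4.3 p. 20 L26–30]
[cite: Greenberg2006, Props. 4.1, 4.2 (§4 A, pp. 367–368)] -/
theorem loc1_and_hasCorank_H0_zero_curve (hK : IsImaginaryQuadratic K) {γ₁ γ₂ : absoluteGaloisGroup K}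
    (hpair : ZpExtension.IsTopGeneratorPair κ₁ κ₂ γ₁ γ₂)
    [TopologicalSpace (PowerSeries ℤ_[p])] [TopologicalSpace (PowerSeries (PowerSeries ℤ_[p]))]
    [IsTopologicalAddGroup (IndModule₂ ℤ_[p] p (PrimaryTorsion W.geomPoints p))]
    [ContinuousSMul (PowerSeries (PowerSeries ℤ_[p])) (IndModule₂ ℤ_[p] p (PrimaryTorsion W.geomPoints p))]
    (S : Set (HeightOneSpectrum (𝓞 K))) (hS : ∀ w : HeightOneSpectrum (𝓞 K), ((p : ℕ) : 𝓞 K) ∈ w.asIdeal → w ∈ S)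
    (ρ₀ : ContinuousRep (GaloisGroupUnramifiedOutside K S) ℤ_[p] (PrimaryTorsion W.geomPoints p)) :
    (∀ w : HeightOneSpectrum (𝓞 K), LOC1 S (twistDeformation S hS κ₁ κ₂ ρ₀) (Sum.inr w)) ∧
      (∀ w : HeightOneSpectrum (𝓞 K),
        HasCorank (IwasawaAlgebra₂ p) ((localRep S (twistDeformation S hS κ₁ κ₂ ρ₀) (Sum.inr w)).H 0) 0) ∧
      HasCorank (IwasawaAlgebra₂ p) ((twistDeformation S hS κ₁ κ₂ ρ₀).H 0) 0 := by
  have hinj : Function.Injective (algebraMap ℤ_[p] ℤ_[p]) := fun a b h ↦ by simpa using h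
  have hA : ∀ a : PrimaryTorsion W.geomPoints p, ∃ k : ℕ, p ^ k • a = 0 :=
    primaryTorsion_exists_pow_nsmul_eq_zero W p
  obtain ⟨Y, _, _, tA, hY, n, ⟨b⟩⟩ := exists_tateDual_basis_primaryTorsion W p
  obtain ⟨hfree, hfin⟩ := (isCofree_primaryTorsion W p).characterModule
  have hY₀ := isDualPairing_characterModule ℤ_[p] (PrimaryTorsion W.geomPoints p)
  let b₀ := (Module.Free.chooseBasis ℤ_[p] (CharacterModule (PrimaryTorsion W.geomPoints p))).reindex
    (Fintype.equivFin _)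
  refine ⟨fun w ↦ ?_, fun w ↦ ?_, hasCorank_H0_zero_of_basis S hS κ₁ κ₂ ρ₀ hinj hA hY₀ b₀⟩
  · obtain ⟨σ, hσ⟩ := exists_resGal_apply_ne_one_of_isTopGeneratorPair K p hK hpair w
    exact twistDeformation_LOC1_of_basis S hS κ₁ κ₂ ρ₀ hinj hA hY b (Sum.inr w) σ hσ
  · obtain ⟨σ, hσ⟩ := exists_resGal_apply_ne_one_of_isTopGeneratorPair K p hK hpair w
    exact hasCorank_localH0_zero_of_basis S hS κ₁ κ₂ ρ₀ hinj hA hY₀ b₀ (Sum.inr w) σ hσ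

end Curve

/-- **Registered stub `stub_twistDeformationLOC1SS` of line `bdpline` (skeleton v19, lead bsd-line-sbc-p1
gen 3), PROVED** — verbatim signature: for `W/K` elliptic, `K` imaginary quadratic, a generator pair, the
canonical `S = {w ∣ p} ∪ {bad w}` and every DESCENDED `ρ₀` on `E[p^∞]`, LOC_w⁽¹⁾ and `corank H⁰(K_w, 𝐃) = 0`
at the places of `S` and `corank H⁰(K_Σ/K, 𝐃) = 0`. A special case of `loc1_and_hasCorank_H0_zero_curve`
(the binders `2 < p`, `κ₁` cyclotomic, `κ₂` anticyclotomic, "`ρ₀` descended" and `w ∈ S` are idle).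
[cite: Greenberg2010, Lemma 5.2.2 (PDF p. 28 L20–21)] [cite: Greenberg2016Selmer, §4.3 p. 20 L26–30] -/
theorem stub_twistDeformationLOC1SS : ∀ (K : Type) [Field K] [NumberField K] (W : WeierstrassCurve K) [W.IsElliptic] (p : ℕ) [Fact p.Prime] (κ₁ κ₂ : Literature.NumberTheory.EllipticCurves.ZpExtension K p) (γ₁ γ₂ : Field.absoluteGaloisGroup K) [Fact (Literature.NumberTheory.EllipticCurves.ZpExtension.IsTopGeneratorPair κ₁ κ₂ γ₁ γ₂)], Literature.NumberTheory.EllipticCurves.IsImaginaryQuadratic K → 2 < p → κ₁.IsCyclotomic → κ₂.IsAnticyclotomic → ∀ [TopologicalSpace (PowerSeries ℤ_[p])] [TopologicalSpace (PowerSeries (PowerSeries ℤ_[p]))] [IsTopologicalRing (PowerSeries (PowerSeries ℤ_[p]))] [IsTopologicalAddGroup (Literature.NumberTheory.IwasawaTheory.Greenberg2006.IndModule₂ ℤ_[p] p (Literature.NumberTheory.EllipticCurves.PrimaryTorsion W.geomPoints p))] [ContinuousSMul (PowerSeries (PowerSeries ℤ_[p])) (Literature.NumberTheory.IwasawaTheory.Greenberg2006.IndModule₂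 ℤ_[p] p (Literature.NumberTheory.EllipticCurves.PrimaryTorsion W.geomPoints p))] (ρ₀ : Literature.NumberTheory.GaloisRepresentations.ContinuousRep (Literature.NumberTheory.GaloisRepresentations.GaloisGroupUnramifiedOutside K {w : IsDedekindDomain.HeightOneSpectrum (NumberField.RingOfIntegers K) | ((p : ℕ) : NumberField.RingOfIntegers K) ∈ w.asIdeal ∨ ¬ W.HasGoodReductionAt w}) ℤ_[p] (Literature.NumberTheory.EllipticCurves.PrimaryTorsion W.geomPoints p)), (∀ (σ : Field.absoluteGaloisGroup K) (P : Literature.NumberTheory.EllipticCurves.PrimaryTorsion W.geomPoints p), ρ₀ (Literature.NumberTheory.GaloisRepresentations.toUnramifiedQuot K _ σ) P = σ • P) → (∀ w : IsDedekindDomain.HeightOneSpectrum (NumberField.RingOfIntegers K), w ∈ {w : IsDedekindDomain.HeightOneSpectrum (NumberField.RingOfIntegers K) | ((p : ℕ) : NumberField.RingOfIntegers K) ∈ w.asIdeal ∨ ¬ W.HasGoodReductionAt w} → Literature.NumberTheory.IwasawaTheory.Greenberg2016.LOC1 _ (Literature.NumberTheory.IwasawaTheory.Greenberg2006.twistDeformation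 _ (Summit.BirchSwinnertonDyer.BirchSwinnertonDyer.Theorems.SignedBaseChangeAcDivFiniteExponentTelescope.mem_badOrP_of_natCast_mem W p) κ₁ κ₂ ρ₀) (Sum.inr w)) ∧ (∀ w : IsDedekindDomain.HeightOneSpectrum (NumberField.RingOfIntegers K), w ∈ {w : IsDedekindDomain.HeightOneSpectrum (NumberField.RingOfIntegers K) | ((p : ℕ) : NumberField.RingOfIntegers K) ∈ w.asIdeal ∨ ¬ W.HasGoodReductionAt w} → Literature.NumberTheory.IwasawaTheory.Greenberg2016.HasCorank (Literature.NumberTheory.EllipticCurves.IwasawaAlgebra₂ p) ((Literature.NumberTheory.IwasawaTheory.Greenberg2016.localRep _ (Literature.NumberTheory.IwasawaTheory.Greenberg2006.twistDeformation _ (Summit.BirchSwinnertonDyer.BirchSwinnertonDyer.Theorems.SignedBaseChangeAcDivFiniteExponentTelescope.mem_badOrP_of_natCast_mem W p) κ₁ κ₂ ρ₀) (Sum.inr w)).H 0) 0) ∧ Literature.NumberTheory.IwasawaTheory.Greenberg2016.HasCorank (Literature.NumberTheory.EllipticCurves.IwasawaAlgebra₂ p) ((Literature.NumberTheory.IwasawaTheory.Greenberg2006.twistDeformation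 _ (Summit.BirchSwinnertonDyer.BirchSwinnertonDyer.Theorems.SignedBaseChangeAcDivFiniteExponentTelescope.mem_badOrP_of_natCast_mem W p) κ₁ κ₂ ρ₀).H 0) 0 := by
  intro K _ _ W _ p _ κ₁ κ₂ γ₁ γ₂ _ hK _hp _hκ₁ _hκ₂ _ _ _ _ _ ρ₀ _hρ₀
  obtain ⟨h1, h0, h00⟩ :=
    loc1_and_hasCorank_H0_zero_curve W κ₁ κ₂ hK
      (Fact.out : Literature.NumberTheory.EllipticCurves.ZpExtension.IsTopGeneratorPair κ₁ κ₂ γ₁ γ₂) _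
      (mem_badOrP_of_natCast_mem W p) ρ₀
  exact ⟨fun w _ ↦ h1 w, fun w _ ↦ h0 w, h00⟩

end Summit.BirchSwinnertonDyer.BirchSwinnertonDyer.Theorems.SignedBaseChangeAcDivTwistLOC1

end
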